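import Literature.Probability.Percolation.RSWLemma
import HarnessLib

/-!
# Below the lowest crossing, by winding numbers: the interface lemma

Topic `Literature/Probability/Percolation`; continuation of `LowestCrossing.lean` and of the
winding-number toolkit of `PlanarDuality.lean` / `RSWLemma.lean`.

For the translation-only Russo–Seymour–Welsh argument of Bollobás–Riordan (2010,
arXiv:1001.4674, §5.1, proof of Thm. 5.3) one splices a fresh configuration above the lowest open
left–right crossing `P₁ = LH(S)` of a square `S = [0, j]²` and needs, for a lattice path that
leaves the region `A` "on or below `P₁`" at a vertex `a` towards a neighbour `u ∉ A`, that
**`a` lies on `P₁`** (so that the path is joined to the crossing). In print this is read off a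
picture; here `A` is defined through the winding number `W = walkWinding P̂` of the extended
crossing `P̂ = extendRight π 0` (`π` the boundary crossing of `exists_bdryWalk`, extended beyond
the right side and downwards, as in `PlanarDuality.lean`): a vertex is *below* if one of the four
faces around it has `W = -1`.

* `IsSquareCrossing.walkWinding_ext_of_mem` — every face of an achieved `D₀ = dualBelow j ω₀`
  has `W = -1` when the edges of `π` are boundary edges of `D₀` (the faces of `D₀` are dual-joined
  to the bottom inside `D₀` without crossing `π`, whose edges are open; non-symmetric version of
  `walkWinding_symExt_of_mem`).
* `IsSquareCrossing.walkWinding_ext_eq_of_mem_dualEdge` — off `π`, the four faces around a vertex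
  of `[0, j] × [0, ∞)` have the same winding number (version of
  `walkWinding_symExt_eq_of_mem_dualEdge`).
* `IsSquareCrossing.mem_support_of_winding` — **the interface lemma**: if some face around `a` has
  `W = -1` and the two faces at the lattice edge `{a, u}` have `W ≠ -1`, then `a ∈ π.support`.
* `IsSquareCrossing.not_mem_of_winding_ne` — faces with `W ≠ -1` are not in `D₀` (so the exit
  edge `{a, u}` bounds no face of `D₀`, and opening it does not change `dualBelow`).
* `exists_subwalk_inter_free` — the minimal sub-walk of a walk from `A` to `B`
  (steps start outside `B` and end outside `A`; Bollobás–Riordan's "minimal subpath `P'`").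
* `dualEdge_map_reflY`, `dualConfig_relabel_reflY` — duality commutes with the reflection
  `reflY c` in a horizontal line, the faces being reflected by `reflY (c - 1)`: the input for
  exploring a square from ABOVE (highest crossing) by reflecting and reusing `dualBelow`.

## References

* B. Bollobás, O. Riordan, *Percolation on self-dual polygon configurations*, Bolyai Soc. Math.
  Stud. 21 (2010), arXiv:1001.4674, §5.1, proof of Thm. 5.3 ("the minimal subpath `P'` of
  `P + X` meeting `A` and `B` … joins `P₁` and `P₂`"). [BollobasRiordan2010]
* H. Kesten, *Percolation theory for mathematicians*, Birkhäuser (1982), §2.2–2.3. [KestenPTM1982]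
-/

namespace Literature.Probability.Percolation

open SimpleGraph Finset

noncomputable section

variable {j : ℕ} {a b : LatticeModels.Site 2}

namespace IsSquareCrossing

variable {π : (LatticeModels.zdGraph 2).Walk a b} (h : IsSquareCrossing j π)
include h

/-- The end of a square crossing has height `≥ 0`. [folklore] -/
theorem end_one_nonneg : 0 ≤ b 1 := (mem_rectangle_iff.1 (h.subset b π.end_mem_support)).2.2.1

/-- The crossing lies at heights in `[0, j]`. [folklore] -/
theorem support_bounds {z : LatticeModels.Site 2} (hz : z ∈ π.support) : 0 ≤ z 0 ∧ z 0 ≤ j ∧ 0 ≤ z 1 ∧ z 1 ≤ j :=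
  mem_rectangle_iff.1 (h.subset z hz)

/-- The end of `P̂ = extendRight π 0` is `(j + 1, -2)`. [folklore] -/
theorem ext_end_apply :
    ((fun w : LatticeModels.Site 2 => w - Pi.single 1 1)^[(b 1 - 0).toNat + 2] (b + Pi.single 0 1)) 0 = j + 1 ∧
    ((fun w : LatticeModels.Site 2 => w - Pi.single 1 1)^[(b 1 - 0).toNat + 2] (b + Pi.single 0 1)) 1 = -2 := by
  have h' := extendRight_end_apply b (B := 0) h.end_one_nonneg
  rw [h'.1, h'.2, h.finish]
  exact ⟨rfl, by ring⟩

/-- Vertices of `P̂`: those of `π`, or on the column `x₀ = j + 1`. [folklore] -/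
theorem mem_support_ext {z : LatticeModels.Site 2} (hz : z ∈ (extendRight π 0).support) :
    z ∈ π.support ∨ z 0 = j + 1 := by
  rcases mem_support_extendRight (P := π) (B := 0) h.end_one_nonneg hz with hz | hz
  · exact Or.inl hz
  · right; rw [hz.1, h.finish]

/-- A vertex of `[0, j] × ℤ` off `π` is off `P̂`. [folklore] -/
theorem notMem_support_ext {v : LatticeModels.Site 2} (hv : v ∉ π.support) (hv0 : v 0 ≤ j) :
    v ∉ (extendRight π 0).support := fun h' => by
  rcases h.mem_support_ext h' with h' | h'
  · exact hv h'
  · omega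

/-- The start `a` (on the left side) is off every `rayAbove z` with `z₀ ≥ 0`. [folklore] -/
theorem start_notMem_rayAbove' {z : LatticeModels.Site 2} (hz : 0 ≤ z 0) : a ∉ rayAbove z := by
  have := h.start
  simp only [mem_rayAbove, not_and, not_le]; intro; omega

/-- The end of `P̂` is off every `rayAbove z` with `z₁ ≥ -2`. [folklore] -/
theorem ext_end_notMem_rayAbove {z : LatticeModels.Site 2} (hz : -2 ≤ z 1) :
    ((fun w : LatticeModels.Site 2 => w - Pi.single 1 1)^[(b 1 - 0).toNat + 2] (b + Pi.single 0 1)) ∉ rayAbove z := by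
  simp only [mem_rayAbove, not_and]
  intro h1
  rw [h.ext_end_apply.2] at h1
  omega

/-- **Below `π`**: `P̂` winds `-1` times around the faces just below the square (`u₁ = -1`,
`u₀ ≤ j`). [folklore] -/
theorem walkWinding_ext_eq_neg_one {u : LatticeModels.Site 2} (hu1 : u 1 = -1) (hu0 : u 0 ≤ j) :
    walkWinding (extendRight π 0) u = -1 :=
  walkWinding_extendRight_bottom (T := j) (fun z hz => ⟨(h.support_bounds hz).2.2.1, (h.support_bounds hz).2.2.2⟩)
    (by rw [hu1]; ring) (by rw [h.finish]; exact hu0)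

/-- **Above `π`**: no winding at heights `≥ j`. [folklore] -/
theorem walkWinding_ext_eq_zero {u : LatticeModels.Site 2} (hu : (j : ℤ) ≤ u 1) :
    walkWinding (extendRight π 0) u = 0 := by
  refine walkWinding_eq_zero_of_le (N := j) (fun z hz => ?_) hu
  rcases mem_support_extendRight (P := π) (B := 0) h.end_one_nonneg hz with hz | hz
  · exact (h.support_bounds hz).2.2.2
  · have := (h.support_bounds π.end_mem_support).2.2.2; omega

/-- **The faces of `D₀` lie below `π`.** If the edges of `π` are boundary edges of `D₀` and
`D₀ = dualBelow j ω₀` is achieved, then `P̂` winds `-1` times around every face of `D₀`: each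
such face is joined to a bottom face by a dual walk inside `D₀`, dual-open in `ω₀`, which
crosses neither an edge of `π` (open in `ω₀`, `mem_of_isBdryEdge`) nor another edge of `P̂`
(those have an endpoint on the column `x₀ = j + 1`). [folklore] -/
theorem walkWinding_ext_of_mem {D₀ : Finset (LatticeModels.Site 2)} {ω₀ : BondConfig (LatticeModels.Site 2)}
    (hbdry : ∀ d ∈ π.darts, IsBdryEdge D₀ j d.edge) (hach : dualBelow j ω₀ = D₀) {f : LatticeModels.Site 2}
    (hf : f ∈ D₀) : walkWinding (extendRight π 0) f = -1 := by
  classical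
  have hf' : f ∈ dualBelow j ω₀ := hach.symm ▸ hf
  obtain ⟨b₀, hb₀, hconn⟩ := exists_openConnIn_dualBelow hf'
  obtain ⟨q, hqS, hqω⟩ :=
    exists_walk_of_mem_openConnIn (fun _ h => h.1 : dualConfig ω₀ ⊆ (LatticeModels.zdGraph 2).edgeSet) hconn
  have hqD : ∀ z ∈ q.support, z ∈ dualRectangle j j := fun z hz =>
    dualBelow_subset (Finset.mem_coe.1 (hqS z hz))
  have hb₀D := mem_dualRectangle_iff.1 (Finset.mem_filter.1 hb₀).1
  rw [← h.walkWinding_ext_eq_neg_one (u := b₀) (Finset.mem_filter.1 hb₀).2 (by omega)]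
  symm
  refine walkWinding_eq_of_faceWalk _ q (fun dq hdq hmem => ?_)
    (fun z hz => h.start_notMem_rayAbove' (mem_dualRectangle_iff.1 (hqD z hz)).1)
    (fun z hz => h.ext_end_notMem_rayAbove (by have := (mem_dualRectangle_iff.1 (hqD z hz)).2.2.1; omega))
  -- the dual step `dq` is dual-open in `ω₀`
  have hdual : s(dq.fst, dq.snd) ∈ dualConfig ω₀ :=
    hqω _ (by rw [Walk.edges]; exact List.mem_map.2 ⟨dq, hdq, rfl⟩)
  have hg := mem_dualRectangle_iff.1 (hqD _ (q.dart_fst_mem_support_of_mem_darts hdq))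
  have hg' := mem_dualRectangle_iff.1 (hqD _ (q.dart_snd_mem_support_of_mem_darts hdq))
  have hsep : ∀ w ∈ sepEdge dq.fst dq.snd, w 0 ≤ j := fun w hw => by
    have := (sepEdge_apply_zero_le hw).1
    have hmax : max (dq.fst 0) (dq.snd 0) ≤ (j : ℤ) - 1 := max_le hg.2.1 hg'.2.1
    omega
  rcases mem_edges_extendRight hmem with hπ | ⟨w, hw, hw0⟩
  · -- an edge of `π`: open in `ω₀`, so its dual is not dual-open
    obtain ⟨d, hd, hde⟩ : ∃ d ∈ π.darts, d.edge = sepEdge dq.fst dq.snd := by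
      rw [Walk.edges] at hπ; exact List.mem_map.1 hπ
    have hopen : sepEdge dq.fst dq.snd ∈ ω₀ :=
      mem_of_isBdryEdge hach (π.edges_subset_edgeSet hπ) (hde ▸ hbdry d hd)
    exact (mem_dualConfig_iff.1 hdual).2 _ hopen (dualEdge_sepEdge dq.adj)
  · have := hsep w hw
    rw [h.finish] at hw0
    omega

/-- **The four faces around a vertex off `π`.** If `v ∈ [0, j] × [0, ∞)` is not on `π`, then `P̂`
winds equally around `v + (½, ½)` and around both faces adjacent to any lattice edge at `v`.
[folklore] -/
theorem walkWinding_ext_eq_of_mem_dualEdge {v : LatticeModels.Site 2}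
    (hv : v ∉ π.support) (hv0 : 0 ≤ v 0) (hv0' : v 0 ≤ j) (hv1 : 0 ≤ v 1)
    {e : Sym2 (LatticeModels.Site 2)} (he : e ∈ (LatticeModels.zdGraph 2).edgeSet) (hve : v ∈ e)
    {g : LatticeModels.Site 2} (hg : g ∈ dualEdge e) :
    walkWinding (extendRight π 0) g = walkWinding (extendRight π 0) v := by
  set P := extendRight π 0 with hP
  have hvP : v ∉ P.support := h.notMem_support_ext hv hv0'
  have hne1 : ∀ w, s(v, w) ∉ P.edges := fun w h' => hvP (P.fst_mem_support_of_mem_edges h')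
  have hne2 : ∀ w, s(w, v) ∉ P.edges := fun w h' => hvP (P.snd_mem_support_of_mem_edges h')
  -- the three other faces around `v`
  have h0 : walkWinding P (v - Pi.single 0 1) = walkWinding P v := by
    have := walkWinding_eq_walkWinding_right (p := P) (u := v - Pi.single 0 1)
      (by rw [sub_add_cancel]; exact hne1 _)
    rwa [sub_add_cancel] at this
  have h1 : walkWinding P (v - Pi.single 1 1) = walkWinding P v := by
    have := walkWinding_eq_walkWinding_up (p := P) (u := v - Pi.single 1 1)
      (by rw [sub_add_cancel]; exact hne1 _)
      (by
        have := h.start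
        simp only [mem_rayAbove, Pi.sub_apply, single_one_apply_zero, not_and, not_le]
        intro; omega)
      (by
        simp only [mem_rayAbove, Pi.sub_apply, single_one_apply_one, sub_add_cancel, not_and]
        intro h'; rw [h.ext_end_apply.2] at h'; omega)
    rwa [sub_add_cancel] at this
  have h01 : walkWinding P (v - Pi.single 0 1 - Pi.single 1 1) = walkWinding P v := by
    rw [← h0]
    have := walkWinding_eq_walkWinding_up (p := P) (u := v - Pi.single 0 1 - Pi.single 1 1)
      (by rw [sub_add_cancel, sub_add_cancel]; exact hne2 _)
      (by
        simp only [mem_rayAbove, Pi.sub_apply, single_one_apply_zero, single_zero_apply_zero,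
          single_one_apply_one, single_zero_apply_one, sub_add_cancel, not_and, not_le]
        intro h1'
        by_contra h0'
        push Not at h0'
        have hva : v = a := by
          have := h.start
          rw [LatticeModels.Site.eq_iff_two]; constructor <;> omega
        exact hv (hva ▸ π.start_mem_support))
      (by
        simp only [mem_rayAbove, Pi.sub_apply, single_one_apply_one, single_zero_apply_one,
          sub_add_cancel, not_and]
        intro h'; rw [h.ext_end_apply.2] at h'; omega)
    rwa [sub_add_cancel] at this
  -- the edge `e` at `v` and its two faces
  obtain ⟨u, hi⟩ := mem_edgeSet_zdGraph_iff.1 he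
  rcases Fin.exists_fin_two.1 hi with rfl | rfl
  · rw [dualEdge_horizontal] at hg
    rcases Sym2.mem_iff.1 hve with rfl | rfl
    · rcases Sym2.mem_iff.1 hg with rfl | rfl
      · exact h1
      · rfl
    · rcases Sym2.mem_iff.1 hg with rfl | rfl
      · rw [← h01, add_sub_cancel_right]
      · rw [← h0, add_sub_cancel_right]
  · rw [dualEdge_vertical] at hg
    rcases Sym2.mem_iff.1 hve with rfl | rfl
    · rcases Sym2.mem_iff.1 hg with rfl | rfl
      · exact h0
      · rfl
    · rcases Sym2.mem_iff.1 hg with rfl | rfl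
      · rw [← h01, sub_right_comm, add_sub_cancel_right]
      · rw [← h1, add_sub_cancel_right]

/-- **The interface lemma.** Let `a ∈ [0, j] × [0, ∞)`. If some face around `a` (a face adjacent
to a lattice edge at `a`) has winding number `-1` ("`a` is on or below `π`") while the two faces
at the lattice edge `e` at `a` have winding number `≠ -1` ("the far end of `e` is strictly above
`π`"), then `a` is a vertex of `π` (otherwise all four faces around `a` would wind equally).
This is the step "the minimal sub-path of `P + X` meeting `A` and `B` … joins `P₁` and `P₂`" of
Bollobás–Riordan's proof of Thm. 5.3, at the `P₁` end. [cite: BollobasRiordan2010, §5.1 proof of Thm. 5.3] -/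
theorem mem_support_of_winding {a' : LatticeModels.Site 2} (ha0 : 0 ≤ a' 0) (ha0' : a' 0 ≤ j) (ha1 : 0 ≤ a' 1)
    {e' : Sym2 (LatticeModels.Site 2)} (he' : e' ∈ (LatticeModels.zdGraph 2).edgeSet) (hae' : a' ∈ e')
    {f : LatticeModels.Site 2} (hf : f ∈ dualEdge e') (hWf : walkWinding (extendRight π 0) f = -1)
    {e : Sym2 (LatticeModels.Site 2)} (he : e ∈ (LatticeModels.zdGraph 2).edgeSet) (hae : a' ∈ e)
    (hWe : ∀ g ∈ dualEdge e, walkWinding (extendRight π 0) g ≠ -1) :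
    a' ∈ π.support := by
  by_contra ha
  have hg := Sym2.out_fst_mem (dualEdge e)
  have h1 := h.walkWinding_ext_eq_of_mem_dualEdge ha ha0 ha0' ha1 he hae hg
  have h2 := h.walkWinding_ext_eq_of_mem_dualEdge ha ha0 ha0' ha1 he' hae' hf
  exact hWe _ hg (by rw [h1, ← h2, hWf])

/-- **Faces strictly above `π` are not below the lowest crossing**: a face with winding number
`≠ -1` is not in `D₀` (contrapositive of `walkWinding_ext_of_mem`). In the splice argument: the
exit edge `{a, u}` of the link bounds no face of `D₀ = dualBelow j ω₁`, so no coordinate of a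
corner at `u` was examined, and opening the edge does not change `dualBelow`. [folklore] -/
theorem not_mem_of_winding_ne {D₀ : Finset (LatticeModels.Site 2)} {ω₀ : BondConfig (LatticeModels.Site 2)}
    (hbdry : ∀ d ∈ π.darts, IsBdryEdge D₀ j d.edge) (hach : dualBelow j ω₀ = D₀) {g : LatticeModels.Site 2}
    (hWg : walkWinding (extendRight π 0) g ≠ -1) : g ∉ D₀ :=
  fun hg => hWg (h.walkWinding_ext_of_mem hbdry hach hg)

/-- **The interface lemma for the lowest crossing** (the form used with `D₀ = dualBelow j ω₁`):
if `a` is a vertex of a lattice edge one of whose faces lies in `D₀`, and the two faces at the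
lattice edge `e` at `a` have winding number `≠ -1`, then `a ∈ π.support` — `a` lies on the open
boundary crossing. [cite: BollobasRiordan2010, §5.1 proof of Thm. 5.3] -/
theorem mem_support_of_face_mem {D₀ : Finset (LatticeModels.Site 2)} {ω₀ : BondConfig (LatticeModels.Site 2)}
    (hbdry : ∀ d ∈ π.darts, IsBdryEdge D₀ j d.edge) (hach : dualBelow j ω₀ = D₀)
    {a' : LatticeModels.Site 2} (ha0 : 0 ≤ a' 0) (ha0' : a' 0 ≤ j) (ha1 : 0 ≤ a' 1)
    {e' : Sym2 (LatticeModels.Site 2)} (he' : e' ∈ (LatticeModels.zdGraph 2).edgeSet) (hae' : a' ∈ e')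
    {f : LatticeModels.Site 2} (hf : f ∈ dualEdge e') (hfD : f ∈ D₀)
    {e : Sym2 (LatticeModels.Site 2)} (he : e ∈ (LatticeModels.zdGraph 2).edgeSet) (hae : a' ∈ e)
    (hWe : ∀ g ∈ dualEdge e, walkWinding (extendRight π 0) g ≠ -1) :
    a' ∈ π.support :=
  h.mem_support_of_winding ha0 ha0' ha1 he' hae' hf (h.walkWinding_ext_of_mem hbdry hach hfD) he hae hWe

end IsSquareCrossing

/-! ### The minimal sub-walk from `A` to `B` -/

section MinimalSubwalk

variable {V : Type*} {G : SimpleGraph V}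

/-- The prefix of a walk up to its first vertex in `O`, with its darts among the original darts
(variant of `exists_prefix_first_mem` recording darts rather than vertices and edges). [folklore] -/
theorem exists_prefix_first_mem_darts {O : Set V} {c d : V} (p : G.Walk c d)
    (hp : ∃ z ∈ p.support, z ∈ O) :
    ∃ v ∈ O, ∃ q : G.Walk c v, (∀ dq ∈ q.darts, dq ∈ p.darts) ∧ ∀ dq ∈ q.darts, dq.fst ∉ O := by
  induction p with
  | nil =>
    rename_i c
    obtain ⟨z, hz, hzO⟩ := hp
    rw [Walk.support_nil, List.mem_singleton] at hz
    subst hz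
    exact ⟨z, hzO, Walk.nil, by simp, by simp⟩
  | cons hadj p ih =>
    rename_i x y d
    by_cases hx : x ∈ O
    · exact ⟨x, hx, Walk.nil, by simp, by simp⟩
    · have hp' : ∃ z ∈ p.support, z ∈ O := by
        obtain ⟨z, hz, hzO⟩ := hp
        rw [Walk.support_cons, List.mem_cons] at hz
        rcases hz with rfl | hz
        · exact absurd hzO hx
        · exact ⟨z, hz, hzO⟩
      obtain ⟨v, hv, q, hqd, hqO⟩ := ih hp'
      refine ⟨v, hv, Walk.cons hadj q, fun dq hdq => ?_, fun dq hdq => ?_⟩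
      · rw [Walk.darts_cons, List.mem_cons] at hdq ⊢
        rcases hdq with rfl | hdq
        · exact Or.inl rfl
        · exact Or.inr (hqd dq hdq)
      · rw [Walk.darts_cons, List.mem_cons] at hdq
        rcases hdq with rfl | hdq
        · exact hx
        · exact hqO dq hdq

/-- **The minimal sub-walk from `A` to `B`.** A walk from a vertex of `A` to a vertex of `B` contains
a sub-walk (its darts among the original ones) from some `a' ∈ A` to some `b' ∈ B` whose steps all
start outside `B` and end outside `A` — so none of its vertices other than `a'`, `b'` lies in
`A ∪ B`: cut at the first visit to `B`, then at the last earlier visit to `A` (Bollobás–Riordan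
2010, proof of Thm. 5.3: "the minimal subpath `P'` of `P + X` meeting `A` and `B` contains bonds
only in `G`"). [cite: BollobasRiordan2010, §5.1 proof of Thm. 5.3] -/
theorem exists_subwalk_inter_free {A B : Set V} {c d : V} (p : G.Walk c d)
    (hc : c ∈ A) (hd : d ∈ B) :
    ∃ a' ∈ A, ∃ b' ∈ B, ∃ q : G.Walk a' b', (∀ dq ∈ q.darts, dq ∈ p.darts) ∧
      (∀ dq ∈ q.darts, dq.fst ∉ B) ∧ ∀ dq ∈ q.darts, dq.snd ∉ A := by
  -- cut at the first visit to `B`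
  obtain ⟨b', hb', p₁, hp₁d, hp₁B⟩ := exists_prefix_first_mem_darts (O := B) p ⟨d, p.end_mem_support, hd⟩
  -- then at the last earlier visit to `A`: the first visit to `A` of the reversed prefix
  obtain ⟨a', ha', p₂, hp₂d, hp₂A⟩ := exists_prefix_first_mem_darts (O := A) p₁.reverse
    ⟨c, by rw [Walk.support_reverse, List.mem_reverse]; exact p₁.start_mem_support, hc⟩
  have key : ∀ dq ∈ p₂.reverse.darts, dq ∈ p₁.darts ∧ dq.snd ∉ A := by
    intro dq hdq
    rw [Walk.darts_reverse, List.mem_reverse, List.mem_map] at hdq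
    obtain ⟨d₂, hd₂, rfl⟩ := hdq
    refine ⟨?_, hp₂A d₂ hd₂⟩
    have := hp₂d d₂ hd₂
    rw [Walk.darts_reverse, List.mem_reverse, List.mem_map] at this
    obtain ⟨d₁, hd₁, rfl⟩ := this
    rw [Dart.symm_symm]
    exact hd₁
  exact ⟨a', ha', b', hb', p₂.reverse, fun dq hdq => hp₁d dq (key dq hdq).1,
    fun dq hdq => hp₁B dq (key dq hdq).1, fun dq hdq => (key dq hdq).2⟩

end MinimalSubwalk

/-! ### Duality commutes with the reflection in a horizontal line

For the highest crossing of a square one explores from ABOVE; the cheapest route is to reflect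
the configuration in the horizontal symmetry axis of the square (`reflY j`, `RSWLemma.lean`) and
to reuse `dualBelow`. The face with lower-left corner `g` is carried by the reflection
`(x₀, x₁) ↦ (x₀, c - x₁)` to the face with lower-left corner `(g₀, c - 1 - g₁) = reflY (c - 1) g`,
so on dual edges and dual configurations the primal reflection `reflY c` acts as `reflY (c - 1)`. -/

section Reflection

open LatticeModels

/-- The reflection of a horizontal unit step. [folklore] -/
theorem reflY_add_single_zero (c : ℤ) (u : Site 2) : reflY c (u + Pi.single 0 1) = reflY c u + Pi.single 0 1 := by
  rw [LatticeModels.Site.eq_iff_two]; simp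

/-- The reflection of a vertical unit step. [folklore] -/
theorem reflY_add_single_one (c : ℤ) (u : Site 2) : reflY c (u + Pi.single 1 1) = reflY c u - Pi.single 1 1 := by
  rw [LatticeModels.Site.eq_iff_two]; simp; ring

/-- `reflY (c - 1)` on the faces realises `reflY c` on the lattice: lower endpoint. [folklore] -/
theorem reflY_pred_sub_single_one (c : ℤ) (u : Site 2) : reflY (c - 1) (u - Pi.single 1 1) = reflY c u := by
  rw [LatticeModels.Site.eq_iff_two]; simp

/-- `reflY (c - 1)` on the faces realises `reflY c` on the lattice: upper endpoint. [folklore] -/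
theorem reflY_pred (c : ℤ) (u : Site 2) : reflY (c - 1) u = reflY c u - Pi.single 1 1 := by
  rw [LatticeModels.Site.eq_iff_two]; simp; ring

/-- `reflY (c - 1)` on the faces realises `reflY c` on the lattice: left neighbour. [folklore] -/
theorem reflY_pred_sub_single_zero (c : ℤ) (u : Site 2) :
    reflY (c - 1) (u - Pi.single 0 1) = reflY c u - Pi.single 1 1 - Pi.single 0 1 := by
  rw [LatticeModels.Site.eq_iff_two]; simp; ring

/-- **Duality commutes with the reflection**, on edges: the dual of the reflected lattice edge is
the reflected dual edge, the faces being reflected by `reflY (c - 1)`. [folklore] -/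
theorem dualEdge_map_reflY (c : ℤ) {e : Sym2 (Site 2)} (he : e ∈ (zdGraph 2).edgeSet) :
    dualEdge (Sym2.map (reflY c) e) = Sym2.map (reflY (c - 1)) (dualEdge e) := by
  obtain ⟨u, i, rfl⟩ := mem_edgeSet_zdGraph_iff.1 he
  fin_cases i
  · simp only [Fin.zero_eta]
    rw [dualEdge_horizontal, Sym2.map_mk, Sym2.map_mk, reflY_add_single_zero, dualEdge_horizontal,
      reflY_pred_sub_single_one, reflY_pred, Sym2.eq_swap]
  · simp only [Fin.mk_one]
    rw [dualEdge_vertical, Sym2.map_mk, Sym2.map_mk, reflY_add_single_one, reflY_pred_sub_single_zero,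
      reflY_pred]
    have : s(reflY c u, reflY c u - Pi.single 1 1) = s(reflY c u - Pi.single 1 1, reflY c u - Pi.single 1 1 + Pi.single 1 1) := by
      rw [sub_add_cancel, Sym2.eq_swap]
    rw [this, dualEdge_vertical]

/-- `dualEdge` commutes with the reflection on all pairs (it is the identity off the lattice
edges, which the reflection preserves). [folklore] -/
theorem dualEdge_map_reflY' (c : ℤ) (e : Sym2 (Site 2)) :
    dualEdge (Sym2.map (reflY c) e) = Sym2.map (reflY (c - 1)) (dualEdge e) ∨ e ∉ (zdGraph 2).edgeSet := by
  by_cases he : e ∈ (zdGraph 2).edgeSet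
  · exact Or.inl (dualEdge_map_reflY c he)
  · exact Or.inr he

/-- The reflection is an involution on pairs. [folklore] -/
theorem map_reflY_map_reflY (c : ℤ) (e : Sym2 (Site 2)) : Sym2.map (reflY c) (Sym2.map (reflY c) e) = e := by
  rw [Sym2.map_map]
  have : (reflY c ∘ reflY c : Site 2 → Site 2) = id := by funext x; simp
  rw [this, Sym2.map_id, id]

/-- The reflection preserves the lattice edges. [folklore] -/
theorem map_reflY_mem_edgeSet_iff (c : ℤ) (z : Sym2 (Site 2)) :
    Sym2.map (reflY c) z ∈ (zdGraph 2).edgeSet ↔ z ∈ (zdGraph 2).edgeSet := by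
  simpa using sym2Equiv_mem_edgeSet_iff (reflY c) z

/-- The underlying map of the reflection as an `Equiv`. [folklore] -/
theorem coe_reflY_toEquiv (c : ℤ) : ⇑((reflY c).toEquiv) = ⇑(reflY c) := rfl

/-- The inverse of the reflection, as a map, is the reflection. [folklore] -/
theorem coe_reflY_toEquiv_symm (c : ℤ) : ⇑((reflY c).toEquiv.symm) = ⇑(reflY c) := by
  funext x
  apply (reflY c).toEquiv.injective
  rw [Equiv.apply_symm_apply]
  simp

/-- **Duality commutes with the reflection**, on configurations: a dual edge is dual-open for the
reflected configuration iff its reflection (by `reflY (c - 1)`) is dual-open for the original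
one. [folklore] -/
theorem map_reflY_mem_dualConfig_relabel_iff (c : ℤ) (ω : BondConfig (Site 2)) (d : Sym2 (Site 2)) :
    Sym2.map (reflY (c - 1)) d ∈ dualConfig (BondConfig.relabel (sym2Equiv (reflY c).toEquiv) ω) ↔
      d ∈ dualConfig ω := by
  simp only [mem_dualConfig_iff, BondConfig.relabel_apply, Set.mem_image, sym2Equiv_apply,
    coe_reflY_toEquiv, map_reflY_mem_edgeSet_iff]
  constructor
  · rintro ⟨hE, hne⟩
    refine ⟨hE, fun e he heq => ?_⟩
    have heE : e ∈ (zdGraph 2).edgeSet := (dualEdge_mem_edgeSet_iff e).1 (heq ▸ hE)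
    exact hne (Sym2.map (reflY c) e) ⟨e, he, rfl⟩ (by rw [dualEdge_map_reflY c heE, heq])
  · rintro ⟨hE, hne⟩
    refine ⟨hE, ?_⟩
    rintro _ ⟨e, he, rfl⟩ heq
    have heE : e ∈ (zdGraph 2).edgeSet := by
      have h1 : dualEdge (Sym2.map (reflY c) e) ∈ (zdGraph 2).edgeSet := by
        rw [heq, map_reflY_mem_edgeSet_iff]; exact hE
      exact (map_reflY_mem_edgeSet_iff c e).1 ((dualEdge_mem_edgeSet_iff _).1 h1)
    refine hne e he ?_
    have h := dualEdge_map_reflY c heE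
    rw [heq] at h
    have := congrArg (Sym2.map (reflY (c - 1))) h
    rw [map_reflY_map_reflY, map_reflY_map_reflY] at this
    exact this.symm

/-- **The dual configuration of the reflected configuration is the reflected dual
configuration** (faces reflected by `reflY (c - 1)`). [folklore] -/
theorem dualConfig_relabel_reflY (c : ℤ) (ω : BondConfig (Site 2)) :
    dualConfig (BondConfig.relabel (sym2Equiv (reflY c).toEquiv) ω) =
      BondConfig.relabel (sym2Equiv (reflY (c - 1)).toEquiv) (dualConfig ω) := by
  ext d
  rw [BondConfig.mem_relabel_iff, sym2Equiv_symm, sym2Equiv_apply, coe_reflY_toEquiv_symm]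
  conv_lhs => rw [← map_reflY_map_reflY (c - 1) d]
  exact map_reflY_mem_dualConfig_relabel_iff c ω _

end Reflection

end

end Literature.Probability.Percolation
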